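import Summits.AtomisticToContinuum.FouriersLaw.Theorems.PuiseuxTransferLedgerTwoModeBulkReduction

/-!
# Strategist sketch (cstrat stmt-AtomisticToContinuum-12111, crux `PuiseuxTransferLedger.TwoModeBulk`)

Signatures quoted in `STRATEGY-CENSUS.md` (Strengthen / Decomposition headings), elaborated here so that the census
quotes only well-typed statements. Nothing is asserted: every `def … : Prop` is a candidate statement, and the two
`theorem`s are the lossless split glue (by the landed rider) and a sanity implication.
-/

noncomputable section

namespace Summit.AtomisticToContinuum.FouriersLaw.Cruxes.TwoModeBulk.Strategist

open MeasureTheory Filter Set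
open Literature.MathematicalPhysics.KineticTheory.HeatConduction
open Summit.AtomisticToContinuum.FouriersLaw.Theorems.BoundaryKubo.Negative.LoadBearing (kuboIntegrand)

/-- The explicit equilibrium Kubo profile `u_N(i) = (γ/T²)∫₀^∞ Cov_(μ₀)(p_0², K_t p_i²) dt − 1/2` of the `(N+1)`-site
open chain with both baths at `T` (the crux's kinetic-temperature response profile, by the landed fixed-`N` stubs). -/
def profileU (ω₂ lam β γ T : ℝ) (N : ℕ) (i : Fin (N + 1)) : ℝ :=
  γ / T ^ 2 * (∫ t in Set.Ioi (0 : ℝ),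
    ((∫ z, (z.2 0) ^ 2 * (∫ y, (y.2 i) ^ 2 ∂((Literature.MathematicalPhysics.KineticTheory.HeatConduction.pinnedChain ω₂ lam β γ).transitionKernel (N + 1) T T t.toNNReal z))
        ∂((Literature.MathematicalPhysics.KineticTheory.HeatConduction.pinnedChain ω₂ lam β γ).gibbsMeasure (N + 1) T)) -
      (∫ z, (z.2 0) ^ 2 ∂((Literature.MathematicalPhysics.KineticTheory.HeatConduction.pinnedChain ω₂ lam β γ).gibbsMeasure (N + 1) T)) *
        (∫ z, (∫ y, (y.2 i) ^ 2 ∂((Literature.MathematicalPhysics.KineticTheory.HeatConduction.pinnedChain ω₂ lam β γ).transitionKernel (N + 1) T T t.toNNReal z))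
          ∂((Literature.MathematicalPhysics.KineticTheory.HeatConduction.pinnedChain ω₂ lam β γ).gibbsMeasure (N + 1) T)))) - 1 / 2

/-- The per-bond conductance `g_N = (γ²/T²)∫₀^∞ Cov(p_0², K_t p_N²) = D_(N+1)/N` (`boundaryKubo_proof`). -/
def conductanceG (ω₂ lam β γ T : ℝ) (N : ℕ) : ℝ :=
  (γ ^ 2 / T ^ 2) * ∫ t in Set.Ioi (0 : ℝ), kuboIntegrand ω₂ lam β γ T N t

/-- Local bond resistance `r_N(i) = (u_N(i) − u_N(i+1))/g_N` of the bond `(i, i+1)`, `i + 1 ≤ N` (junk when `i = N`: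
the successor index wraps through `Fin.last`; never used there). -/
def localResistance (ω₂ lam β γ T : ℝ) (N : ℕ) (i : Fin (N + 1)) : ℝ :=
  (profileU ω₂ lam β γ T N i - profileU ω₂ lam β γ T N (if h : i.val + 1 < N + 1 then ⟨i.val + 1, h⟩ else Fin.last N)) /
    conductanceG ω₂ lam β γ T N

/-! ## Decomposition: the lossless split (children = registered stubs, `kuboIntegrand` kept folded here) -/

/-- Child (L): layer relaxation of the second differences (registered `stub_layerRelaxation`). -/
def LayerRelaxation : Prop :=
  ∀ ω₂ lam β γ : ℝ, 0 < ω₂ → 0 < lam → 0 < β → 0 < γ → ∀ T : ℝ, 0 < T → ∃ θ C : ℝ, 0 ≤ θ ∧ θ < 1 ∧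
    ∀ (N : ℕ) (i j k : Fin (N + 1)), j.val = i.val + 1 → k.val = i.val + 2 →
      |profileU ω₂ lam β γ T N i - 2 * profileU ω₂ lam β γ T N j + profileU ω₂ lam β γ T N k| ≤
        C * |conductanceG ω₂ lam β γ T N| * (θ ^ i.val + θ ^ (N - 2 - i.val))

/-- Child (B): exponentially accurate mid-chain slope (registered `stub_bulkSlope`). -/
def BulkSlope : Prop :=
  ∀ ω₂ lam β γ : ℝ, 0 < ω₂ → 0 < lam → 0 < β → 0 < γ → ∀ T : ℝ, 0 < T → ∃ r θ C : ℝ, 0 ≤ θ ∧ θ < 1 ∧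
    ∀ (N : ℕ) (i j : Fin (N + 1)), i.val = N / 2 → j.val = i.val + 1 →
      |profileU ω₂ lam β γ T N i - profileU ω₂ lam β γ T N j - r * conductanceG ω₂ lam β γ T N| ≤
        C * |conductanceG ω₂ lam β γ T N| * θ ^ N

/-- The split glue IS the landed rider (definitional unfolding of `profileU`, `conductanceG`). -/
theorem twoModeBulk_of_subs : LayerRelaxation → BulkSlope →
    Summit.AtomisticToContinuum.FouriersLaw.Theses.PuiseuxTransferLedger.TwoModeBulk :=
  Summit.AtomisticToContinuum.FouriersLaw.Theorems.TwoModeBulk.Sketch.twoModeBulk_of_stubs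

/-! ## Strengthen: candidate rigid forms `S⁺` quoted in the census -/

/-- `S⁺₂` FAR-CONTACT DECOUPLING (one-sided, explicit-profile form): the local resistance of bond `(i,i+1)` changes by at
most `C θ^(N-1-i)` when one site is inserted before the far (right) bath. With (L) it implies (B) (Cauchy in `N` at the
middle bond), and with the cruxes it gives the by-product `ExponentiallyAffineResistance`
(`exponentiallyAffineResistance_of_cruxes`). Not filed: an `N`-uniform spatial-gap statement of the same depth as (B). -/
def FarContactDecoupling : Prop :=
  ∀ ω₂ lam β γ : ℝ, 0 < ω₂ → 0 < lam → 0 < β → 0 < γ → ∀ T : ℝ, 0 < T → ∃ θ C : ℝ, 0 ≤ θ ∧ θ < 1 ∧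
    ∀ (N : ℕ) (i : Fin (N + 1)) (i' : Fin (N + 2)), i.val + 1 ≤ N → i'.val = i.val →
      |localResistance ω₂ lam β γ T N i - localResistance ω₂ lam β γ T (N + 1) i'| ≤ C * θ ^ (N - 1 - i.val)

/-- `S⁺₄` DIFFUSIVE `L²` DECAY of the equal-temperature open chain (the input of the nongradient/corrector transplant):
hypocoercive decay at rate `≥ c/(N+1)²`, prefactor `C`, both independent of `N`. Not excluded by the catalogued
gap-closing barrier (which gives `N⁻³` only at the HARMONIC = ballistic member); open for the anharmonic chain, and by itself
it yields neither exponential layers nor the `θ^N` rate (census §Strengthen). -/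
def DiffusiveDecay : Prop :=
  ∀ ω₂ lam β γ : ℝ, 0 < ω₂ → 0 < lam → 0 < β → 0 < γ → ∀ T : ℝ, 0 < T → ∃ c C : ℝ, 0 < c ∧
    ∀ (N : ℕ) (f : PhaseSpace (N + 1) → ℝ), Measurable f → (∀ x, |f x| ≤ 1) → ∀ t : ℝ, 0 ≤ t →
      ∫ z, ((∫ y, f y ∂((Literature.MathematicalPhysics.KineticTheory.HeatConduction.pinnedChain ω₂ lam β γ).transitionKernel (N + 1) T T t.toNNReal z)) -
          ∫ y, f y ∂((Literature.MathematicalPhysics.KineticTheory.HeatConduction.pinnedChain ω₂ lam β γ).gibbsMeasure (N + 1) T)) ^ 2 ∂((Literature.MathematicalPhysics.KineticTheory.HeatConduction.pinnedChain ω₂ lam β γ).gibbsMeasure (N + 1) T) ≤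
        C * Real.exp (-(2 * c * t / ((N : ℝ) + 1) ^ 2)) *
          ∫ z, (f z - ∫ y, f y ∂((Literature.MathematicalPhysics.KineticTheory.HeatConduction.pinnedChain ω₂ lam β γ).gibbsMeasure (N + 1) T)) ^ 2 ∂((Literature.MathematicalPhysics.KineticTheory.HeatConduction.pinnedChain ω₂ lam β γ).gibbsMeasure (N + 1) T)

/-- The MINIMAL form the route's `closes` consumes (summable layers, explicit-profile language; the lead's
`SummableLayersBulk` read through `twoModeBulk_iff_twoModeProfile`). WEAKER than the crux — recorded for the negation
heading (a refutation of (B)'s rate would be `refuted-misstated` with this as the repair), not a decomposition. -/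
def SummableLayersProfile : Prop :=
  ∀ ω₂ lam β γ : ℝ, 0 < ω₂ → 0 < lam → 0 < β → 0 < γ → ∀ T : ℝ, 0 < T → ∃ r B : ℝ,
    ∀ N : ℕ, (∑ i : Fin (N + 1), if i.val + 1 ≤ N then
        |localResistance ω₂ lam β γ T N i - r| else 0) ≤ B

end Summit.AtomisticToContinuum.FouriersLaw.Cruxes.TwoModeBulk.Strategist

end
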